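import Summits.ResolutionOfSingularities.ResolutionOfSingularities.Theorems.EquisingularLiftEquisingularLiftNatTwoStepVertex
import Summits.ResolutionOfSingularities.ResolutionOfSingularities.Theorems.EquisingularLiftEquisingularLiftNatSecondOrderGraphChartData
import HarnessLib

/-!
# [OURS] `A₃` VERTICES ARE TWO-STEP POINTS — the first family pushed through the whole level-1 bridge: polynomial `A₃` recognition
# (✓ …SecondOrderA3Recognition) ⟹ the two-step data of ✓ `twoStepAt_vertex` ⟹ the point of `V₊(F)` over the vertex is TWO-STEP (level `1`)
# (cruxes `Theses.EquisingularLift.EquisingularLiftNat` / `…NatThree` / `EquisingularLift`, stmt-ResolutionOfSingularities-20038 / -20148 / -15660)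

[OURS · leafhand-res-equisingularlift-11 g0, 2026-08-31; cell `pub/decomp-res`] AI-produced, weaker than expert review; NOT a statement of any manuscript;
nothing here proves resolution of singularities in positive characteristic.  DEF-FREE helper; no `sorry`; standard axioms; ZERO named hypotheses.

* `SecondOrderPoint.mem_pow_of_isHomogeneous` — a form of degree `k` lies in `(T)^k`;
* ★★ `SecondOrderPoint.twoStepData_A₃` — for the `A₃` vertex chart `f = y₀y₁ + ((y₂²(αy₀ + βy₁) + Ψ₁⁰) + (γy₂⁴ + Ψ₂⁰ + Ψ₅))` (`Ψ₁⁰ ∈ (y₀,y₁)²` cubic form,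
  `Ψ₂⁰ ∈ (y₀,y₁)` quartic form, `Ψ₅ ∈ (y)⁵`, `γ ≠ αβ`, every characteristic) the complete TWO-STEP DATA consumed by ✓ `OneStep.twoStepAt_origin` /
  ✓ `twoStepAt_vertex`: strict transforms `G_a` for the three charts with the total-transform identities (`μ = 2`, `Φ = y₀y₁`), the disjunctive Jacobian
  datum, and second-order splittings with one-step data for every chart (graph charts: ✓ `secondOrderData_of_graphChart`; chart `2`: the node
  `Φ' = T₀T₁ + αT₀T₂ + βT₁T₂ + γT₂²` of ✓ `A₃_recognition_chart₂`);
* ★★★ `twoStepAt_vertex_A₃` — `F` a form of positive degree whose vertex chart `F(x_c := 1)` is such an `f` (and radical): the point of `V₊(F)` over `P_c`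
  is a closed TWO-STEP point — for every blow-up at it, finitely many closed ONE-STEP points over it and regularity elsewhere over it (level `1` of the
  depth towers; with ✓ `PointChain.chain_of_twoStepPoints`: such points are resolved by the downstairs point chain in two rounds).

Honest label: closes no registered stub (it certifies which `H` the isolated residual EXCLUDES at depth `1`).

References: [Hartshorne1977, I Thm. 5.1, I Ex. 5.6, II Ex. 7.12]; `A₃ → A₁ → ∅` under point blow-ups (classical); through the cited tree files.
-/

set_option linter.dupNamespace false -- mandated namespace `Summit.<Summit>.<Problem>` of this single-conjunct summit

noncomputable section

open CategoryTheory CategoryTheory.Limits AlgebraicGeometry TopologicalSpace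
open Literature.AlgebraicGeometry.Resolution Literature.AlgebraicGeometry.Motives
open AlgebraicGeometry.Scheme.IdealSheafData
open MvPolynomial HomogeneousLocalization
open Literature.AlgebraicGeometry.Motives.SmoothHypersurface Literature.AlgebraicGeometry.Motives.ProjectiveSpace
open Summit.ResolutionOfSingularities.ResolutionOfSingularities.Cruxes.EquisingularLift.StrataSplit

namespace Summit.ResolutionOfSingularities.ResolutionOfSingularities.Cruxes.EquisingularLiftNat.Sections

namespace SecondOrderPoint

variable (K : Type) [Field K] {n : ℕ}

/-- A form of degree `k` lies in `(T)^k`. [folklore] -/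
theorem mem_pow_of_isHomogeneous {φ : MvPolynomial (Fin n) K} {k : ℕ} (h : φ.IsHomogeneous k) :
    φ ∈ Ideal.span (Set.range (X : Fin n → MvPolynomial (Fin n) K)) ^ k := by
  change φ ∈ MvPolynomial.idealOfVars (Fin n) K ^ k
  refine (MvPolynomial.mem_pow_idealOfVars_iff k φ).mpr fun d hd => ?_
  have h' := h (mem_support_iff.mp hd)
  rw [Finsupp.degree_eq_weight_one]
  exact h'.symm.le

/-- ★★ **THE TWO-STEP DATA OF AN `A₃` POINT** (every characteristic): strict transforms for the three charts with `μ = 2`, `Φ = y₀y₁`, the disjunctive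
Jacobian datum and second-order splittings with one-step data — the hypotheses `G, hG, hjac, hsec` of ✓ `OneStep.twoStepAt_origin` / ✓ `twoStepAt_vertex`.
[cite: Hartshorne1977, I Thm. 5.1, II Ex. 7.12] -/
theorem twoStepData_A₃ (α β γ : K) (hdisc : γ ≠ α * β) {Ψ₁₀ Ψ₂₀ Ψ₅ : MvPolynomial (Fin 3) K}
    (hΨ₁₀h : Ψ₁₀.IsHomogeneous 3) (hΨ₁₀ : Ψ₁₀ ∈ Ideal.span {(X 0 : MvPolynomial (Fin 3) K), X 1} ^ 2)
    (hΨ₂₀h : Ψ₂₀.IsHomogeneous 4) (hΨ₂₀ : Ψ₂₀ ∈ Ideal.span {(X 0 : MvPolynomial (Fin 3) K), X 1})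
    (hΨ₅ : Ψ₅ ∈ Ideal.span (Set.range (X : Fin 3 → MvPolynomial (Fin 3) K)) ^ 5) :
    ((X 2 ^ 2 * (C α * X 0 + C β * X 1) + Ψ₁₀) + (C γ * X 2 ^ 4 + Ψ₂₀ + Ψ₅) : MvPolynomial (Fin 3) K) ∈
        Ideal.span (Set.range (X : Fin 3 → MvPolynomial (Fin 3) K)) ^ (2 + 1) ∧
    ∃ G : Fin 3 → MvPolynomial (Fin 3) K,
      (∀ a, aeval (fun j => X a * Function.update (X : Fin 3 → MvPolynomial (Fin 3) K) a 1 j)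
        (X 0 * X 1 + ((X 2 ^ 2 * (C α * X 0 + C β * X 1) + Ψ₁₀) + (C γ * X 2 ^ 4 + Ψ₂₀ + Ψ₅))) = X a ^ 2 * G a) ∧
      (∀ a, ∀ P : Ideal (MvPolynomial (Fin 3) K), P.IsPrime → (X a : MvPolynomial (Fin 3) K) ∈ P → G a ∈ P →
        (∃ j, pderiv j (G a) ∉ P) ∨ ∀ i, (X i : MvPolynomial (Fin 3) K) ∈ P) ∧
      (∀ a, G a ∈ Ideal.span (Set.range (X : Fin 3 → MvPolynomial (Fin 3) K)) →
        ∃ (μ' : ℕ) (Φ' Ψ' : MvPolynomial (Fin 3) K), 1 ≤ μ' ∧ Φ'.IsHomogeneous μ' ∧ Φ' ≠ 0 ∧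
          Ψ' ∈ Ideal.span (Set.range (X : Fin 3 → MvPolynomial (Fin 3) K)) ^ (μ' + 1) ∧ G a = Φ' + Ψ' ∧
          ∀ b : Fin 3, ∃ G' : MvPolynomial (Fin 3) K,
            aeval (fun j => X b * Function.update (X : Fin 3 → MvPolynomial (Fin 3) K) b 1 j) (Φ' + Ψ') = X b ^ μ' * G' ∧
            ∀ P : Ideal (MvPolynomial (Fin 3) K), P.IsPrime → (X b : MvPolynomial (Fin 3) K) ∈ P → G' ∈ P → ∃ j, pderiv j G' ∉ P) := by
  classical
  set I : Ideal (MvPolynomial (Fin 3) K) := Ideal.span (Set.range (X : Fin 3 → MvPolynomial (Fin 3) K)) with hIdef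
  have hX : ∀ i : Fin 3, (X i : MvPolynomial (Fin 3) K) ∈ I := fun i => Ideal.subset_span (Set.mem_range_self i)
  have hlin : (C α * X 0 + C β * X 1 : MvPolynomial (Fin 3) K) ∈ I := I.add_mem (I.mul_mem_left _ (hX 0)) (I.mul_mem_left _ (hX 1))
  have hΨ : ((X 2 ^ 2 * (C α * X 0 + C β * X 1) + Ψ₁₀) + (C γ * X 2 ^ 4 + Ψ₂₀ + Ψ₅) : MvPolynomial (Fin 3) K) ∈ I ^ (2 + 1) := by
    refine Ideal.add_mem _ (Ideal.add_mem _ ?_ (mem_pow_of_isHomogeneous K hΨ₁₀h)) (Ideal.add_mem _ (Ideal.add_mem _ ?_ ?_) ?_)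
    · rw [pow_succ]
      exact Ideal.mul_mem_mul (Ideal.pow_mem_pow (hX 2) 2) hlin
    · exact Ideal.mul_mem_left _ _ (Ideal.pow_le_pow_right (by norm_num) (Ideal.pow_mem_pow (hX 2) 4))
    · exact Ideal.pow_le_pow_right (by norm_num) (mem_pow_of_isHomogeneous K hΨ₂₀h)
    · exact Ideal.pow_le_pow_right (by norm_num) hΨ₅
  refine ⟨hΨ, ?_⟩
  -- the three charts
  obtain ⟨G₀, hG₀, hG₀'⟩ := strictTransform_A_chart₀ K hΨ
  obtain ⟨G₁, hG₁, hG₁'⟩ := strictTransform_A_chart₁ K hΨ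
  obtain ⟨Ψ₁', Ψ'', hΨ₁'h, hΨ''m, hid₂, hprod₂, hone₂⟩ := A₃_recognition_chart₂ K α β γ hdisc hΨ₁₀h hΨ₁₀ hΨ₂₀h hΨ₂₀ hΨ₅
  rw [add_assoc (X 0 * X 1 : MvPolynomial (Fin 3) K)] at hid₂
  let G : Fin 3 → MvPolynomial (Fin 3) K :=
    ![G₀, G₁, (X 0 * X 1 + C α * (X 0 * X 2) + C β * (X 1 * X 2) + C γ * X 2 ^ 2) + (Ψ₁' + Ψ'')]
  have hG0 : G 0 = G₀ := rfl
  have hG1 : G 1 = G₁ := rfl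
  have hG2 : G 2 = (X 0 * X 1 + C α * (X 0 * X 2) + C β * (X 1 * X 2) + C γ * X 2 ^ 2) + (Ψ₁' + Ψ'') := rfl
  refine ⟨G, ?_, ?_, ?_⟩
  · intro a
    fin_cases a
    · exact hG₀
    · exact hG₁
    · exact hid₂
  · intro a P hP hXa hGa
    fin_cases a
    · exact Or.inl ⟨1, pderiv_not_mem_of_sub_X_mem_span K (by decide) hG₀' P hP hXa⟩
    · exact Or.inl ⟨0, pderiv_not_mem_of_sub_X_mem_span K (by decide) hG₁' P hP hXa⟩
    · by_cases hall : ∀ j, pderiv j (G 2) ∈ P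
      · exact Or.inr (hprod₂ P hXa (hall 0) (hall 1))
      · push Not at hall
        exact Or.inl hall
  · intro a _
    fin_cases a
    · exact secondOrderData_of_graphChart K (by decide : (1 : Fin 3) ≠ 0) hG₀'
    · exact secondOrderData_of_graphChart K (by decide : (0 : Fin 3) ≠ 1) hG₁'
    · have hΦ' : (X 0 * X 1 + C α * (X 0 * X 2) + C β * (X 1 * X 2) + C γ * X 2 ^ 2 : MvPolynomial (Fin 3) K).IsHomogeneous 2 := by
        have h01 := (isHomogeneous_X K (0 : Fin 3)).mul (isHomogeneous_X K (1 : Fin 3))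
        have h02 := (isHomogeneous_C (Fin 3) α).mul ((isHomogeneous_X K (0 : Fin 3)).mul (isHomogeneous_X K (2 : Fin 3)))
        have h12 := (isHomogeneous_C (Fin 3) β).mul ((isHomogeneous_X K (1 : Fin 3)).mul (isHomogeneous_X K (2 : Fin 3)))
        have h22 := (isHomogeneous_C (Fin 3) γ).mul (isHomogeneous_X_pow (2 : Fin 3) 2 (R := K))
        have h := ((h01.add (by simpa using h02)).add (by simpa using h12)).add (by simpa using h22)
        simpa using h
      have hΦ'0 : (X 0 * X 1 + C α * (X 0 * X 2) + C β * (X 1 * X 2) + C γ * X 2 ^ 2 : MvPolynomial (Fin 3) K) ≠ 0 := by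
        intro h
        have h1 := congrArg (fun q => pderiv 0 (pderiv 1 q)) h
        simp only [map_add, pderiv_mul, pderiv_C, pderiv_pow, pderiv_X_self, pderiv_X_of_ne (show (0 : Fin 3) ≠ 1 by decide),
          pderiv_X_of_ne (show (2 : Fin 3) ≠ 1 by decide), pderiv_X_of_ne (show (1 : Fin 3) ≠ 0 by decide),
          pderiv_X_of_ne (show (2 : Fin 3) ≠ 0 by decide), map_zero] at h1
        norm_num at h1
      refine ⟨2, _, Ψ₁' + Ψ'', by norm_num, hΦ', hΦ'0, ?_, rfl, hone₂⟩
      exact Ideal.add_mem _ (mem_pow_of_isHomogeneous K hΨ₁'h) (Ideal.pow_le_pow_right (by norm_num) hΨ''m)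

end SecondOrderPoint

/-- ★★★ **`A₃` VERTICES ARE TWO-STEP POINTS.**  `F ∈ K[x₀,…,x₃]` a form of positive degree, `c` a coordinate whose vertex chart is an `A₃` chart
`F(x_c := 1) = y₀y₁ + ((y₂²(αy₀ + βy₁) + Ψ₁⁰) + (γy₂⁴ + Ψ₂⁰ + Ψ₅))` (`γ ≠ αβ`, `Ψ₁⁰ ∈ (y₀,y₁)²` cubic form, `Ψ₂⁰ ∈ (y₀,y₁)` quartic form, `Ψ₅ ∈ (y)⁵`,
the chart radical).  Then the point `x₀ ∈ V₊(F)` over `P_c` is a closed TWO-STEP point: every blow-up of `V₊(F)` at the reduced point `x₀` is regular over `x₀`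
except at finitely many closed ONE-STEP points (level `1` of the depth towers). [OURS] [cite: Hartshorne1977, I Thm. 5.1, I Ex. 5.6] -/
theorem twoStepAt_vertex_A₃ (K : Type) [Field K] (F : MvPolynomial (Fin (1 + 2 + 1)) K) {d : ℕ} (hF : F.IsHomogeneous d) (hd : 0 < d)
    (c : Fin (1 + 2 + 1)) (α β γ : K) (hdisc : γ ≠ α * β) {Ψ₁₀ Ψ₂₀ Ψ₅ : MvPolynomial (Fin 3) K}
    (hΨ₁₀h : Ψ₁₀.IsHomogeneous 3) (hΨ₁₀ : Ψ₁₀ ∈ Ideal.span {(X 0 : MvPolynomial (Fin 3) K), X 1} ^ 2)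
    (hΨ₂₀h : Ψ₂₀.IsHomogeneous 4) (hΨ₂₀ : Ψ₂₀ ∈ Ideal.span {(X 0 : MvPolynomial (Fin 3) K), X 1})
    (hΨ₅ : Ψ₅ ∈ Ideal.span (Set.range (X : Fin 3 → MvPolynomial (Fin 3) K)) ^ 5)
    (hdeh : ProjectiveSpace.dehomogenize K c F =
      X 0 * X 1 + ((X 2 ^ 2 * (C α * X 0 + C β * X 1) + Ψ₁₀) + (C γ * X 2 ^ 4 + Ψ₂₀ + Ψ₅)))
    (hrad : (Ideal.span {(X 0 * X 1 + ((X 2 ^ 2 * (C α * X 0 + C β * X 1) + Ψ₁₀) + (C γ * X 2 ^ 4 + Ψ₂₀ + Ψ₅)) : MvPolynomial (Fin 3) K)}).radical =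
      Ideal.span {(X 0 * X 1 + ((X 2 ^ 2 * (C α * X 0 + C β * X 1) + Ψ₁₀) + (C γ * X 2 ^ 4 + Ψ₂₀ + Ψ₅)) : MvPolynomial (Fin 3) K)}) :
    letI := MvPolynomial.gradedAlgebra (σ := Fin (1 + 2 + 1)) (R := K)
    ∃ (x₀ : ↥(hypersurface F).left) (hx₀cl : IsClosed ({x₀} : Set ↥(hypersurface F).left)),
      (∀ a : Fin (1 + 2 + 1), a ≠ c → (X a : MvPolynomial (Fin (1 + 2 + 1)) K) ∈ ((hypersurfaceι F).left x₀).asHomogeneousIdeal) ∧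
      ∀ (Z : Scheme.{0}) (τ : Z ⟶ (hypersurface F).left), IsBlowup τ (vanishingIdeal ⟨{x₀}, hx₀cl⟩) →
        ∃ S' : Finset Z, (∀ z : Z, τ z = x₀ → z ∉ S' → IsRegularLocalRing (Z.presheaf.stalk z)) ∧
          ∀ z ∈ S', τ z = x₀ ∧ ∃ hz : IsClosed ({z} : Set Z), ∀ (Z' : Scheme.{0}) (τ' : Z' ⟶ Z),
            IsBlowup τ' (vanishingIdeal ⟨{z}, hz⟩) → ∀ z' : Z', τ' z' = z → IsRegularLocalRing (Z'.presheaf.stalk z') := by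
  obtain ⟨hΨ, G, hG, hjac, hsec⟩ := SecondOrderPoint.twoStepData_A₃ K α β γ hdisc hΨ₁₀h hΨ₁₀ hΨ₂₀h hΨ₂₀ hΨ₅
  have hΦ : (X 0 * X 1 : MvPolynomial (Fin 3) K).IsHomogeneous 2 := by
    simpa using (isHomogeneous_X K (0 : Fin 3)).mul (isHomogeneous_X K (1 : Fin 3))
  have hΦ0 : (X 0 * X 1 : MvPolynomial (Fin 3) K) ≠ 0 := mul_ne_zero (X_ne_zero 0) (X_ne_zero 1)
  exact twoStepAt_vertex K F hF hd c (X 0 * X 1) _ (by norm_num) hΦ hΦ0 hΨ hdeh hrad G hG hjac hsec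

end Summit.ResolutionOfSingularities.ResolutionOfSingularities.Cruxes.EquisingularLiftNat.Sections

end
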